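import Literature.AnabelianGeometry.SemiGraphs.TemperedTorsionPoints
import Literature.AnabelianGeometry.SemiGraphs.TemperedCurveHyperbolicWitness
import Literature.AnabelianGeometry.SemiGraphs.TemperedAnabelianWitness
import Literature.AnabelianGeometry.SemiGraphs.TemperedCurveBridge
import Literature.AnabelianGeometry.SemiGraphs.TemperedCurveGalois
import Literature.AnabelianGeometry.AbsoluteAnabelian.SubpadicSlimProofs
import Literature.AnabelianGeometry.AbsoluteAnabelian.SubpadicExamples

/-!
# [SemiAnbd] §6: NON-VACUITY of `TemperedCurve.TorsionPointData` and `TemperedCurve.GroupLevelData`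
# (NV-L3 wave)

S. Mochizuki, *Semi-graphs of anabelioids*, Publ. RIMS **42** (2006) 221–322, §6, author's manuscript
pp. 69–75: the §6 setting `X_K` over a finite extension `K` of `ℚ_p` (typed interface
`TemperedCurve p`, abc-iut-L3-t4), the torsion closed points of Thm. 6.8 (iii) p. 75
(`TemperedCurve.TorsionPointData`), and the group-level parameter bundle of the bridge to
[SemiAnbd] Ex. 3.10 (`TemperedCurve.GroupLevelData`, abc-iut-L3-t2/t4: `G_K ≅ Gal(K̄/K)`, "`Π`, `Δ`
tempered", "`Π`, `Δ` temp-slim", "`Π` Galois-countable") [cite: MochizukiSemiAnbd2006, §6 pp.69-75].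

abc-iut cell, layer L3, PROOF-ONLY non-vacuity file (seat abc-iut-w5-d149 gen 3; row family «NV-L3»,
abc-iut-w4-d098's INHABITATION-CENSUS-L3-v1 §A1: `TemperedCurve.TorsionPointData` and
`TemperedCurve.GroupLevelData` have ZERO producers).  No `def`, no `instance`, no `structure`, no
named fact; witnesses are built inside theorem terms.  HONEST LABELS:

* `TorsionPointData X a` — exact inhabitation content first (`isTorsionPt_of_torsionPointData`: the
  torsion locus is nonempty whenever the datum exists; `nonempty_torsionPointData_of_eq_singleton`: a
  one-point torsion locus is always parametrised), then a GENUINE-SHAPED witness at the tree's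
  non-degenerate model `TemperedCurve.toyHyperbolic p` (abc-iut, `TemperedCurveHyperbolicWitness.lean`:
  one closed point, a cusp — for `X = E ∖ {O}` the cusp `O` IS a torsion point of `E`), with the
  law-free flags record `CurveArithmeticFlags` (row of abc-iut-w4-d082, not witnessed here as a row)
  chosen inline so that the torsion locus is that point.
* `GroupLevelData X` — at the model `TemperedCurve.degenerate p` (`K = ℚ_p`, `Π := G_{ℚ_p}`): every
  field is then an HONEST THEOREM about `G_{ℚ_p}` — `galEquiv` = the G11 identification
  `TemperedCurve.galoisIdentification` (abc-iut-L3-t12), "tempered" = profinite ⇒ tempered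
  (`IsTempered.of_profinite`, Rmk. 3.1.1), "slim" = `G_{ℚ_p}` slim ([pGC] Lem. 15.8 for the
  sub-`p`-adic field `ℚ_p`, PROVED in the tree: `IsSubpadicFor.isSlimGroup_absoluteGaloisGroup`),
  `Δ = 1` tempered and slim trivially — EXCEPT "Galois-countable" (`SecondCountableTopology (GQp p)`),
  which `nonempty_groupLevelData_degenerate` takes as an INSTANCE HYPOTHESIS: it follows from the
  tree's named fact `localEulerPoincareCharacteristic` (Tate; PROVED Summits-side as
  `localEulerPoincareCharacteristic_holds`) via topological finite generation of `G_{ℚ_p}`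
  (`isTopologicallyFinitelyGenerated_absoluteGaloisGroup_padic_of_localEPC`, [NSW] 7.5.10) and
  `IsTopologicallyFinitelyGenerated.secondCountableTopology` ([IUTchI] Rmk. 2.5.3 (ii) (E2)) — that
  derivation is NOT imported here (its module `MLFGaloisTFGProofs` had no built olean at filing time)
  and is left to a sequel.  DEGENERATE as a curve (no closed points), GENUINE as group theory of
  `G_{ℚ_p}`, CONDITIONAL on Galois-countability of `G_{ℚ_p}`.

Nothing in this file takes a side on [IUTchIII] Cor. 3.12; a witness is consistency evidence for an
interface, not an endorsement; typed ≠ proved.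
-/

noncomputable section

namespace Literature.AnabelianGeometry.SemiGraphs

open Literature.AlgebraicGeometry.Frobenioids (IsSlimGroup)
open Literature.AnabelianGeometry.AbsoluteAnabelian

namespace TemperedCurve

variable {p : ℕ} [Fact p.Prime]

/-! ## 1. `TorsionPointData` ([SemiAnbd] Thm. 6.8 (iii) p. 75) -/

/-- **Exact content, necessary half**: if the torsion closed points are parametrised by
`Δ_X^ab ⊗ ℚ/ℤ` (a `TorsionPointData`), the torsion locus is NONEMPTY — it contains the point under the
parameter `0` (for `X = E ∖ {O}`: the origin). [cite: MochizukiSemiAnbd2006, Thm 6.8(iii) p.75] -/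
theorem isTorsionPt_of_torsionPointData {X : TemperedCurve p} {a : CurveArithmeticFlags X}
    (T : TorsionPointData X a) : ∃ x : X.Pt, a.IsTorsionPt x := by
  have h : T.torsionPt 0 ∈ {x | a.IsTorsionPt x} := T.range_torsionPt ▸ Set.mem_range_self 0
  exact ⟨T.torsionPt 0, h⟩

/-- **Exact content, parametric sufficient half**: whenever the torsion locus of the flags `a` is a
single closed point `x₀`, the constant parametrisation is a `TorsionPointData` (the torsion module
`Δ_X^ab ⊗ ℚ/ℤ` is nonempty). PARAMETRIC witness. [cite: MochizukiSemiAnbd2006, Thm 6.8(iii) p.75] -/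
theorem nonempty_torsionPointData_of_eq_singleton {X : TemperedCurve p} (a : CurveArithmeticFlags X)
    (x₀ : X.Pt) (h : {x | a.IsTorsionPt x} = {x₀}) : Nonempty (TorsionPointData X a) :=
  ⟨{ torsionPt := fun _ => x₀
     range_torsionPt := by rw [h, Set.range_const] }⟩

/-- **GENUINE-SHAPED witness at the tree's non-degenerate model** `TemperedCurve.toyHyperbolic p`
(base field `ℚ_p`, `Π^temp := G_{ℚ_p} × (Ẑ × P)`, ONE closed point, a cusp): with the arithmetic flags
declaring that point torsion (faithful to `X = E ∖ {O}`, whose cusp `O` is the origin of `E`; the other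
flags are law-free `Prop`s of abc-iut-L3-t4's record and are set to `True`), the torsion closed points
ARE parametrised by `Δ_X^ab ⊗ ℚ/ℤ` (constantly).  HONEST LABEL: toy curve; the genuine parametrisation
by `E(K̄)_tors` is the TODO-merge datum of abc-iut-L4-t1. [cite: MochizukiSemiAnbd2006, Thm 6.8(iii) p.75] -/
theorem exists_torsionPointData_toyHyperbolic :
    ∃ a : CurveArithmeticFlags (toyHyperbolic p),
      a.IsOncePuncturedElliptic ∧ (∀ x, a.IsTorsionPt x) ∧ Nonempty (TorsionPointData (toyHyperbolic p) a) := by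
  refine ⟨{ IsOncePuncturedElliptic := True
            IsTorsionPt := fun _ => True
            IsIsogenousToGenusZero := True
            IsAlgebraicPt := fun _ => True
            IsDefinedOverNumberField := True }, trivial, fun _ => trivial, ?_⟩
  refine nonempty_torsionPointData_of_eq_singleton _ (PUnit.unit : (toyHyperbolic p).Pt) ?_
  ext x
  simp only [Set.mem_setOf_eq, Set.mem_singleton_iff, true_iff]
  rfl

/-- In particular `TorsionPointData` is inhabited at some curve datum and flags (census form).
[cite: MochizukiSemiAnbd2006, Thm 6.8(iii) p.75] -/
theorem exists_nonempty_torsionPointData :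
    ∃ (X : TemperedCurve p) (a : CurveArithmeticFlags X), Nonempty (TorsionPointData X a) := by
  obtain ⟨a, -, -, h⟩ := exists_torsionPointData_toyHyperbolic (p := p)
  exact ⟨toyHyperbolic p, a, h⟩

/-! ## 2. `GroupLevelData` at `TemperedCurve.degenerate p` (`K = ℚ_p`, `Π := G_{ℚ_p}`) -/

/-- `Δ^temp` of the degenerate model is trivial (`aug = id`). [cite: MochizukiSemiAnbd2006, §6 p.69] -/
theorem degenerate_deltaTemp_eq_bot : (degenerate p).DeltaTemp = ⊥ := by
  refine (Subgroup.eq_bot_iff_forall _).mpr fun x hx => ?_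
  exact (MonoidHom.mem_ker).mp hx

/-- Hence the kernel of the `Gal(K̄/K)`-valued augmentation of the degenerate model is trivial, for any
identification `ι`. [cite: MochizukiSemiAnbd2006, §6 p.69] -/
theorem degenerate_ker_augK_eq_bot (ι : (degenerate p).GK ≃ₜ* Field.absoluteGaloisGroup (degenerate p).K) :
    ((degenerate p).augK ι).toMonoidHom.ker = ⊥ := by
  rw [ker_augK, degenerate_deltaTemp_eq_bot]

/-- "`Π` is tempered" at the degenerate model: `G_{ℚ_p}` is profinite, hence tempered (Rmk. 3.1.1,
`IsTempered.of_profinite`). GENUINE. [cite: MochizukiSemiAnbd2006, Rmk 3.1.1 p.33] -/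
theorem isTempered_GQp : IsTempered (GQp p) := by
  haveI : IsGalois ℚ_[p] (AlgebraicClosure ℚ_[p]) := {}
  exact IsTempered.of_profinite

/-- "`Π` is temp-slim" at the degenerate model: `G_{ℚ_p}` is slim — [pGC] Lemma 15.8 for the
sub-`p`-adic field `ℚ_p`, PROVED in the tree (`IsSubpadicFor.isSlimGroup_absoluteGaloisGroup`). GENUINE.
[cite: MochizukiLocAn1999, Lem 15.8 p.80] -/
theorem isSlimGroup_GQp : IsSlimGroup (GQp p) :=
  IsSubpadicFor.isSlimGroup_absoluteGaloisGroup (AbsTopIII.IsSubpadicFor.padic p)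

/-- A subgroup equal to `⊥` is tempered as a topological group in its own right (it is a finite,
hence profinite, group). [cite: MochizukiSemiAnbd2006, Rmk 3.1.1 p.33] -/
theorem isTempered_subgroup_of_eq_bot {G : Type} [Group G] [TopologicalSpace G] [IsTopologicalGroup G]
    [TotallyDisconnectedSpace G] (H : Subgroup G) (hH : H = ⊥) : IsTempered H := by
  haveI : Subsingleton H :=
    ⟨fun a b => Subtype.ext ((Subgroup.mem_bot.mp (hH ▸ a.2)).trans (Subgroup.mem_bot.mp (hH ▸ b.2)).symm)⟩
  haveI : Finite H := Finite.of_subsingleton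
  exact IsTempered.of_profinite

/-- A subgroup equal to `⊥` is slim as a topological group in its own right (every subgroup, in
particular every centraliser, is `⊥`). [cite: MochizukiFrdI2008, §0 p.13] -/
theorem isSlimGroup_subgroup_of_eq_bot {G : Type} [Group G] [TopologicalSpace G] (H : Subgroup G)
    (hH : H = ⊥) : IsSlimGroup H := by
  haveI : Subsingleton H :=
    ⟨fun a b => Subtype.ext ((Subgroup.mem_bot.mp (hH ▸ a.2)).trans (Subgroup.mem_bot.mp (hH ▸ b.2)).symm)⟩
  exact ⟨fun K _ => Subgroup.eq_bot_of_subsingleton _⟩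

/-- **`GroupLevelData` at the degenerate model, given Galois-countability of `G_{ℚ_p}` as an instance
hypothesis**: `galEquiv :=` the G11 identification `galoisIdentification` (abc-iut-L3-t12), `Π = G_{ℚ_p}`
tempered and slim (theorems above), `Δ = 1` tempered and slim.  DEGENERATE as a curve, GENUINE as
group theory. [cite: MochizukiSemiAnbd2006, Ex 3.10 pp.43-45] -/
theorem nonempty_groupLevelData_degenerate [SecondCountableTopology (GQp p)] :
    Nonempty (GroupLevelData (degenerate p)) := by
  haveI : IsGalois ℚ_[p] (AlgebraicClosure ℚ_[p]) := {}
  -- the model's `PiTemp` is `GQp p` by definition, but instance search does not unfold `degenerate`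
  haveI : TotallyDisconnectedSpace (degenerate p).PiTemp := by
    change TotallyDisconnectedSpace (GQp p); infer_instance
  haveI hsc : SecondCountableTopology (degenerate p).PiTemp := by
    change SecondCountableTopology (GQp p); infer_instance
  exact
    ⟨{ galEquiv := (degenerate p).galoisIdentification
       isTempered := isTempered_GQp
       isTempered_ker := isTempered_subgroup_of_eq_bot _ (degenerate_ker_augK_eq_bot _)
       isSlimGroup := isSlimGroup_GQp
       isSlimGroup_ker := isSlimGroup_subgroup_of_eq_bot _ (degenerate_ker_augK_eq_bot _)
       secondCountableTopology := hsc }⟩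

/-- Consequently (same hypothesis) the bridge of abc-iut-L3-lead's ruling η fires at the degenerate model:
a `TemperedArithmeticGroup ℚ_p`-datum of [SemiAnbd] Ex. 3.10 with `Π := G_{ℚ_p}` is obtained through
`toTemperedArithmeticGroup`. [cite: MochizukiSemiAnbd2006, Ex 3.10 p.43] -/
theorem exists_toTemperedArithmeticGroup_degenerate [SecondCountableTopology (GQp p)] :
    ∃ d : GroupLevelData (degenerate p), ((degenerate p).toTemperedArithmeticGroup d).Pi = GQp p :=
  ⟨(nonempty_groupLevelData_degenerate (p := p)).some, rfl⟩

end TemperedCurve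

end Literature.AnabelianGeometry.SemiGraphs

end
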